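import Summits.BirchSwinnertonDyer.Rank1Residual.X12.O11.RouteUBiprimeMember
import Summits.BirchSwinnertonDyer.Rank1Residual.X12.O11.RouteUJacobiCertificate
import HarnessLib

/-!
# ROUTE U, composite member `D = −51 = −3·17` (curve `49a1^{(−51)}`, `N = 49·51² = 127449`), Heegner field
# `K'' = ℚ(√−47)`: the two Bernoulli-unit certificates and BSD₇ by the bi-prime-member class theorem

bsd-cm cell (run/shared/lean/pub/bsd-cm/), ROUTE U, seat `bsd-cm-ram` (g5). Instance of
`RouteU.bsdp_seven_of_twist_cm7_biprime` at `(q₁, q₂, r) = (3, 17, 47)`: `51 ≡ 47 ≡ 3 (mod 4)`,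
`(−47/7) = (−47/3) = (−47/17) = 1`. The member `49a1^{(−51)}` is an O11 pair at `7` (CM by `ℚ(√−7)`,
`7` ramified); it is NOT in `𝒞₇` (a prime factor of `51` is inert in `ℚ(√−7)`), so only BSD₇ is drawn.
The per-member inputs are the two kernel certificates (`decide +kernel`, mod-`49` sums of lengths `357`
and `16779`, the second in 12 blocks of ≤ 1500 terms; the Jacobi symbol `J(j|51)` is
rewritten as `J(j|3)J(j|17)` and each prime Jacobi symbol as a `Fact`-free Euler-criterion `if`
(`RouteUJacobiCertificate.jacobiSym_prime_eq_ite`), so no `Fact (Nat.Prime _)` instance is declared here):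
* `norm_generalizedBernoulli_theta1_D51` — `‖B_{1,ω⁴χ_{−51}}‖₇ = 1`;
* `norm_generalizedBernoulli_theta2_D51` — `‖B_{1,ωχ_{−51}χ_{−47}}‖₇ = 1`;
* **`bsdp_seven_of_twist_cm7_D51`** — BSD₇ for every globally minimal model of `49a1^{(−51)}` with
  `r_an = 1`, from the class theorem (named facts: Kriz–Li Thm 1.20 / Rem 3.10, Gross–Zagier, Kolyvagin,
  GZK, modularity, Rubin 1983 Thm C, Burungale–Flach 2024, Buhler–Gross 1985 Ch. II; displayed data:
  Heegner datum over `ℚ(√−47)`, a Mordell–Weil coordinate over `K`, `L(W^{(−47)},1) ≠ 0`, the twin's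
  minimal model, `7 ∤ c` (Manin constant)).
THEOREMS ONLY; nothing booked. References: [KrizLi2019] Thm. 1.20; [Washington1997] §5.1, Thm 4.2;
[Rubin1983] Thm C; [BuhlerGross1985] Ch. II; [BurungaleFlach2024] Thm 1.1; [Miller2011LMS] Def. 1.1.
-/

noncomputable section

open scoped Classical
open NumberField WeierstrassCurve DirichletCharacter
open Literature.NumberTheory.EllipticCurves Literature.NumberTheory.EllipticCurves.Rank1Residual
open Literature.NumberTheory.EllipticCurves.KrizLi2019 Literature.NumberTheory.LFunctions
open Literature.NumberTheory.EllipticCurves.ModularForms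

namespace Summit.BirchSwinnertonDyer.Rank1Residual.X12.O11.RouteU

/-- `ord₇ (7·51) = 1`. [folklore] -/
theorem padicValNat_seven_level1_D51 : padicValNat 7 (7 * (3 * 17)) = 1 := by
  rw [padicValNat.mul (by norm_num) (by norm_num), padicValNat_self, padicValNat.eq_zero_of_not_dvd (by norm_num)]

/-- `ord₇ (7·51·47) = 1`. [folklore] -/
theorem padicValNat_seven_level2_D51 : padicValNat 7 (7 * (3 * 17) * 47) = 1 := by
  rw [show (7 * (3 * 17) * 47 : ℕ) = 7 * (51 * 47) by norm_num, padicValNat.mul (by norm_num) (by norm_num),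
    padicValNat_self, padicValNat.eq_zero_of_not_dvd (by norm_num)]

/-- `J(a | 3·17) = J(a | 3)·J(a | 17)`. [cite: Cox2013, §1.C Lemma 1.14] -/
theorem jacobiSym_D51_eq (x : ℤ) : jacobiSym x (3 * 17) = jacobiSym x 3 * jacobiSym x 17 :=
  jacobiSym_mul_right' x (by norm_num) (by norm_num)

set_option maxRecDepth 400000 in
/-- **`‖B_{1,θ₁}‖₇ = 1`** for every character `θ₁` mod `7·51` with values `J(j|51)·ω(j)⁴`, `ω`
Teichmüller (certificate `7 ∥ Σ_{j<357} (j/3)(j/17) j²⁹`, `decide +kernel`).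
[cite: KrizLi2019, Thm. 1.20 (p. 8) and §1.5 (1)] [cite: Washington1997, §5.1 and Thm. 4.2] -/
theorem norm_generalizedBernoulli_theta1_D51 (ω : DirichletCharacter ℚ_[7] 7)
    (hω : IsTeichmullerCharacter ω) (θ : DirichletCharacter ℚ_[7] (7 * (3 * 17)))
    (hθ : ∀ j : ZMod (7 * (3 * 17)), θ j =
      (jacobiSym (j.val : ℤ) (3 * 17) : ℚ_[7]) * ω (j.val : ZMod 7) ^ 4) :
    ‖generalizedBernoulli 1 θ‖ = 1 := by
  have hθ' : ∀ j : ZMod (7 * (3 * 17)), θ j =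
      ((jacobiSym (j.val : ℤ) 3 * jacobiSym (j.val : ℤ) 17 : ℤ) : ℚ_[7]) * ω (j.val : ZMod 7) ^ 4 :=
    fun j => by rw [hθ j, jacobiSym_D51_eq]
  have hθ1 : θ ≠ 1 := by
    intro h1
    have hv := hθ' (((356 : ℕ)) : ZMod (7 * (3 * 17)))
    have hval : (((356 : ℕ) : ZMod (7 * (3 * 17)))).val = 356 := by
      rw [ZMod.val_natCast]
    have h6 : (((356 : ℕ)) : ZMod 7) = ((6 : ℕ) : ZMod 7) := by decide
    have hu : IsUnit (((356 : ℕ)) : ZMod (7 * (3 * 17))) := by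
      rw [ZMod.isUnit_iff_coprime]; norm_num
    rw [h1, hval, MulChar.one_apply hu, h6, apply_neg_one_pow_four, mul_one] at hv
    have hL : jacobiSym ((356 : ℕ) : ℤ) 3 * jacobiSym ((356 : ℕ) : ℤ) 17 = -1 := by
      rw [jacobiSym_prime_eq_ite 3 (by norm_num) (by norm_num),
        jacobiSym_prime_eq_ite 17 (by norm_num) (by norm_num)]; decide
    rw [hL] at hv
    norm_num at hv
  refine norm_generalizedBernoulli_one_eq_one_of_cert θ hθ1 padicValNat_seven_level1_D51
    (fun j => jacobiSym (j.val : ℤ) 3 * jacobiSym (j.val : ℤ) 17) 28 (fun j => ?_) ?_ ?_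
  · have := norm_sub_le_of_values ω hω θ
      (fun n => jacobiSym (n : ℤ) 3 * jacobiSym (n : ℤ) 17) 4 (by norm_num) hθ' j
    simpa using this
  · simp_rw [jacobiSym_prime_eq_ite 3 (by norm_num) (by norm_num),
      jacobiSym_prime_eq_ite 17 (by norm_num) (by norm_num)]
    decide +kernel
  · simp_rw [jacobiSym_prime_eq_ite 3 (by norm_num) (by norm_num),
      jacobiSym_prime_eq_ite 17 (by norm_num) (by norm_num)]
    decide +kernel

set_option maxRecDepth 400000 in
/-- Block 0 of the `θ₂` certificate for `D = −51`: `Σ_{0 ≤ j < 1500} (j/3)(j/17)(j/47) j⁸` evaluated (`decide +kernel`). [folklore] -/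
theorem theta2_D51_block0 :
    ∑ j ∈ Finset.Ico (0 : ℕ) 1500,
      (jacobiSym (j : ℤ) 3 * jacobiSym (j : ℤ) 17 * jacobiSym (j : ℤ) 47) * (j : ℤ) ^ (7 + 1) = -403645181977412125456322495 := by
  simp_rw [jacobiSym_prime_eq_ite 3 (by norm_num) (by norm_num), jacobiSym_prime_eq_ite 17 (by norm_num) (by norm_num),
    jacobiSym_prime_eq_ite 47 (by norm_num) (by norm_num)]
  decide +kernel

set_option maxRecDepth 400000 in
/-- Block 1 of the `θ₂` certificate for `D = −51`: `Σ_{1500 ≤ j < 3000} (j/3)(j/17)(j/47) j⁸` evaluated (`decide +kernel`). [folklore] -/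
theorem theta2_D51_block1 :
    ∑ j ∈ Finset.Ico (1500 : ℕ) 3000,
      (jacobiSym (j : ℤ) 3 * jacobiSym (j : ℤ) 17 * jacobiSym (j : ℤ) 47) * (j : ℤ) ^ (7 + 1) = 60288050904796653756948684790 := by
  simp_rw [jacobiSym_prime_eq_ite 3 (by norm_num) (by norm_num), jacobiSym_prime_eq_ite 17 (by norm_num) (by norm_num),
    jacobiSym_prime_eq_ite 47 (by norm_num) (by norm_num)]
  decide +kernel

set_option maxRecDepth 400000 in
/-- Block 2 of the `θ₂` certificate for `D = −51`: `Σ_{3000 ≤ j < 4500} (j/3)(j/17)(j/47) j⁸` evaluated (`decide +kernel`). [folklore] -/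
theorem theta2_D51_block2 :
    ∑ j ∈ Finset.Ico (3000 : ℕ) 4500,
      (jacobiSym (j : ℤ) 3 * jacobiSym (j : ℤ) 17 * jacobiSym (j : ℤ) 47) * (j : ℤ) ^ (7 + 1) = 606703320750966685972210629219 := by
  simp_rw [jacobiSym_prime_eq_ite 3 (by norm_num) (by norm_num), jacobiSym_prime_eq_ite 17 (by norm_num) (by norm_num),
    jacobiSym_prime_eq_ite 47 (by norm_num) (by norm_num)]
  decide +kernel

set_option maxRecDepth 400000 in
/-- Block 3 of the `θ₂` certificate for `D = −51`: `Σ_{4500 ≤ j < 6000} (j/3)(j/17)(j/47) j⁸` evaluated (`decide +kernel`). [folklore] -/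
theorem theta2_D51_block3 :
    ∑ j ∈ Finset.Ico (4500 : ℕ) 6000,
      (jacobiSym (j : ℤ) 3 * jacobiSym (j : ℤ) 17 * jacobiSym (j : ℤ) 47) * (j : ℤ) ^ (7 + 1) = -8044181363874660010843234760297 := by
  simp_rw [jacobiSym_prime_eq_ite 3 (by norm_num) (by norm_num), jacobiSym_prime_eq_ite 17 (by norm_num) (by norm_num),
    jacobiSym_prime_eq_ite 47 (by norm_num) (by norm_num)]
  decide +kernel

set_option maxRecDepth 400000 in
/-- Block 4 of the `θ₂` certificate for `D = −51`: `Σ_{6000 ≤ j < 7500} (j/3)(j/17)(j/47) j⁸` evaluated (`decide +kernel`). [folklore] -/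
theorem theta2_D51_block4 :
    ∑ j ∈ Finset.Ico (6000 : ℕ) 7500,
      (jacobiSym (j : ℤ) 3 * jacobiSym (j : ℤ) 17 * jacobiSym (j : ℤ) 47) * (j : ℤ) ^ (7 + 1) = 151807288815158337916354262773872 := by
  simp_rw [jacobiSym_prime_eq_ite 3 (by norm_num) (by norm_num), jacobiSym_prime_eq_ite 17 (by norm_num) (by norm_num),
    jacobiSym_prime_eq_ite 47 (by norm_num) (by norm_num)]
  decide +kernel

set_option maxRecDepth 400000 in
/-- Block 5 of the `θ₂` certificate for `D = −51`: `Σ_{7500 ≤ j < 9000} (j/3)(j/17)(j/47) j⁸` evaluated (`decide +kernel`). [folklore] -/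
theorem theta2_D51_block5 :
    ∑ j ∈ Finset.Ico (7500 : ℕ) 9000,
      (jacobiSym (j : ℤ) 3 * jacobiSym (j : ℤ) 17 * jacobiSym (j : ℤ) 47) * (j : ℤ) ^ (7 + 1) = -830730843991981827138253677313144 := by
  simp_rw [jacobiSym_prime_eq_ite 3 (by norm_num) (by norm_num), jacobiSym_prime_eq_ite 17 (by norm_num) (by norm_num),
    jacobiSym_prime_eq_ite 47 (by norm_num) (by norm_num)]
  decide +kernel

set_option maxRecDepth 400000 in
/-- Block 6 of the `θ₂` certificate for `D = −51`: `Σ_{9000 ≤ j < 10500} (j/3)(j/17)(j/47) j⁸` evaluated (`decide +kernel`). [folklore] -/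
theorem theta2_D51_block6 :
    ∑ j ∈ Finset.Ico (9000 : ℕ) 10500,
      (jacobiSym (j : ℤ) 3 * jacobiSym (j : ℤ) 17 * jacobiSym (j : ℤ) 47) * (j : ℤ) ^ (7 + 1) = 3259301669634164843834572771174541 := by
  simp_rw [jacobiSym_prime_eq_ite 3 (by norm_num) (by norm_num), jacobiSym_prime_eq_ite 17 (by norm_num) (by norm_num),
    jacobiSym_prime_eq_ite 47 (by norm_num) (by norm_num)]
  decide +kernel

set_option maxRecDepth 400000 in
/-- Block 7 of the `θ₂` certificate for `D = −51`: `Σ_{10500 ≤ j < 12000} (j/3)(j/17)(j/47) j⁸` evaluated (`decide +kernel`). [folklore] -/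
theorem theta2_D51_block7 :
    ∑ j ∈ Finset.Ico (10500 : ℕ) 12000,
      (jacobiSym (j : ℤ) 3 * jacobiSym (j : ℤ) 17 * jacobiSym (j : ℤ) 47) * (j : ℤ) ^ (7 + 1) = -2249597200858432595778493329056853 := by
  simp_rw [jacobiSym_prime_eq_ite 3 (by norm_num) (by norm_num), jacobiSym_prime_eq_ite 17 (by norm_num) (by norm_num),
    jacobiSym_prime_eq_ite 47 (by norm_num) (by norm_num)]
  decide +kernel

set_option maxRecDepth 400000 in
/-- Block 8 of the `θ₂` certificate for `D = −51`: `Σ_{12000 ≤ j < 13500} (j/3)(j/17)(j/47) j⁸` evaluated (`decide +kernel`). [folklore] -/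
theorem theta2_D51_block8 :
    ∑ j ∈ Finset.Ico (12000 : ℕ) 13500,
      (jacobiSym (j : ℤ) 3 * jacobiSym (j : ℤ) 17 * jacobiSym (j : ℤ) 47) * (j : ℤ) ^ (7 + 1) = -30022799819933750816617945886011673 := by
  simp_rw [jacobiSym_prime_eq_ite 3 (by norm_num) (by norm_num), jacobiSym_prime_eq_ite 17 (by norm_num) (by norm_num),
    jacobiSym_prime_eq_ite 47 (by norm_num) (by norm_num)]
  decide +kernel

set_option maxRecDepth 400000 in
/-- Block 9 of the `θ₂` certificate for `D = −51`: `Σ_{13500 ≤ j < 15000} (j/3)(j/17)(j/47) j⁸` evaluated (`decide +kernel`). [folklore] -/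
theorem theta2_D51_block9 :
    ∑ j ∈ Finset.Ico (13500 : ℕ) 15000,
      (jacobiSym (j : ℤ) 3 * jacobiSym (j : ℤ) 17 * jacobiSym (j : ℤ) 47) * (j : ℤ) ^ (7 + 1) = 63484208165623028537591211661697777 := by
  simp_rw [jacobiSym_prime_eq_ite 3 (by norm_num) (by norm_num), jacobiSym_prime_eq_ite 17 (by norm_num) (by norm_num),
    jacobiSym_prime_eq_ite 47 (by norm_num) (by norm_num)]
  decide +kernel

set_option maxRecDepth 400000 in
/-- Block 10 of the `θ₂` certificate for `D = −51`: `Σ_{15000 ≤ j < 16500} (j/3)(j/17)(j/47) j⁸` evaluated (`decide +kernel`). [folklore] -/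
theorem theta2_D51_block10 :
    ∑ j ∈ Finset.Ico (15000 : ℕ) 16500,
      (jacobiSym (j : ℤ) 3 * jacobiSym (j : ℤ) 17 * jacobiSym (j : ℤ) 47) * (j : ℤ) ^ (7 + 1) = -38378139977233886915243129524761208 := by
  simp_rw [jacobiSym_prime_eq_ite 3 (by norm_num) (by norm_num), jacobiSym_prime_eq_ite 17 (by norm_num) (by norm_num),
    jacobiSym_prime_eq_ite 47 (by norm_num) (by norm_num)]
  decide +kernel

set_option maxRecDepth 400000 in
/-- Block 11 of the `θ₂` certificate for `D = −51`: `Σ_{16500 ≤ j < 16779} (j/3)(j/17)(j/47) j⁸` evaluated (`decide +kernel`). [folklore] -/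
theorem theta2_D51_block11 :
    ∑ j ∈ Finset.Ico (16500 : ℕ) (7 * (3 * 17) * 47),
      (jacobiSym (j : ℤ) 3 * jacobiSym (j : ℤ) 17 * jacobiSym (j : ℤ) 47) * (j : ℤ) ^ (7 + 1) = 17365883892679184409782201164887615 := by
  simp_rw [jacobiSym_prime_eq_ite 3 (by norm_num) (by norm_num), jacobiSym_prime_eq_ite 17 (by norm_num) (by norm_num),
    jacobiSym_prime_eq_ite 47 (by norm_num) (by norm_num)]
  decide +kernel

/-- The `θ₂` certificate sum for `D = −51` assembled from its blocks, `7 ∥ S₂`. [folklore] -/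
theorem theta2_D51_sum :
    ∑ j ∈ Finset.range (7 * (3 * 17) * 47),
      (jacobiSym (j : ℤ) 3 * jacobiSym (j : ℤ) 17 * jacobiSym (j : ℤ) 47) * (j : ℤ) ^ (7 + 1) = 12772555581096083100263277911622144 := by
  rw [Finset.range_eq_Ico, ← Finset.sum_Ico_consecutive _ (show 0 ≤ 1500 by norm_num) (show 1500 ≤ 7 * (3 * 17) * 47 by norm_num), ← Finset.sum_Ico_consecutive _ (show 1500 ≤ 3000 by norm_num) (show 3000 ≤ 7 * (3 * 17) * 47 by norm_num), ← Finset.sum_Ico_consecutive _ (show 3000 ≤ 4500 by norm_num) (show 4500 ≤ 7 * (3 * 17) * 47 by norm_num), ← Finset.sum_Ico_consecutive _ (show 4500 ≤ 6000 by norm_num) (show 6000 ≤ 7 * (3 * 17) * 47 by norm_num), ← Finset.sum_Ico_consecutive _ (show 6000 ≤ 7500 by norm_num) (show 7500 ≤ 7 * (3 * 17) * 47 by norm_num), ← Finset.sum_Ico_consecutive _ (show 7500 ≤ 9000 by norm_num) (show 9000 ≤ 7 * (3 * 17) * 47 by norm_num), ← Finset.sum_Ico_consecutive _ (show 9000 ≤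 10500 by norm_num) (show 10500 ≤ 7 * (3 * 17) * 47 by norm_num), ← Finset.sum_Ico_consecutive _ (show 10500 ≤ 12000 by norm_num) (show 12000 ≤ 7 * (3 * 17) * 47 by norm_num), ← Finset.sum_Ico_consecutive _ (show 12000 ≤ 13500 by norm_num) (show 13500 ≤ 7 * (3 * 17) * 47 by norm_num), ← Finset.sum_Ico_consecutive _ (show 13500 ≤ 15000 by norm_num) (show 15000 ≤ 7 * (3 * 17) * 47 by norm_num), ← Finset.sum_Ico_consecutive _ (show 15000 ≤ 16500 by norm_num) (show 16500 ≤ 7 * (3 * 17) * 47 by norm_num), theta2_D51_block0, theta2_D51_block1, theta2_D51_block2, theta2_D51_block3, theta2_D51_block4, theta2_D51_block5, theta2_D51_block6, theta2_D51_block7, theta2_D51_block8, theta2_D51_block9, theta2_D51_block10, theta2_D51_block11]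
  norm_num

set_option maxRecDepth 400000 in
/-- **`‖B_{1,θ₂}‖₇ = 1`** for every character `θ₂` mod `7·51·47` with values `J(j|51)·J(j|47)·ω(j)`
(certificate `7 ∥ Σ_{j<16779} (j/3)(j/17)(j/47) j⁸`, `decide +kernel`).
[cite: KrizLi2019, Thm. 1.20 (p. 8) and §1.5 (1)] [cite: Washington1997, §5.1 and Thm. 4.2] -/
theorem norm_generalizedBernoulli_theta2_D51 (ω : DirichletCharacter ℚ_[7] 7)
    (hω : IsTeichmullerCharacter ω) (θ : DirichletCharacter ℚ_[7] (7 * (3 * 17) * 47))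
    (hθ : ∀ j : ZMod (7 * (3 * 17) * 47), θ j =
      ((jacobiSym (j.val : ℤ) (3 * 17) * jacobiSym (j.val : ℤ) 47 : ℤ) : ℚ_[7]) * ω (j.val : ZMod 7) ^ 1) :
    ‖generalizedBernoulli 1 θ‖ = 1 := by
  have hθ' : ∀ j : ZMod (7 * (3 * 17) * 47), θ j =
      ((jacobiSym (j.val : ℤ) 3 * jacobiSym (j.val : ℤ) 17 * jacobiSym (j.val : ℤ) 47 : ℤ) : ℚ_[7]) *
        ω (j.val : ZMod 7) ^ 1 :=
    fun j => by rw [hθ j, jacobiSym_D51_eq]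
  have hθ1 : θ ≠ 1 := by
    intro h1
    have hv := hθ' (((16778 : ℕ)) : ZMod (7 * (3 * 17) * 47))
    have hval : (((16778 : ℕ) : ZMod (7 * (3 * 17) * 47))).val = 16778 := by
      rw [ZMod.val_natCast]
    have hu : IsUnit (((16778 : ℕ)) : ZMod (7 * (3 * 17) * 47)) := by
      rw [ZMod.isUnit_iff_coprime]; norm_num
    rw [h1, hval, MulChar.one_apply hu, pow_one] at hv
    have hL : jacobiSym ((16778 : ℕ) : ℤ) 3 * jacobiSym ((16778 : ℕ) : ℤ) 17 *
        jacobiSym ((16778 : ℕ) : ℤ) 47 = 1 := by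
      rw [jacobiSym_prime_eq_ite 3 (by norm_num) (by norm_num),
        jacobiSym_prime_eq_ite 17 (by norm_num) (by norm_num),
        jacobiSym_prime_eq_ite 47 (by norm_num) (by norm_num)]; decide
    rw [hL, Int.cast_one, one_mul] at hv
    -- `ω(−1) = 1` contradicts `‖ω(6) − 6‖ < 1`
    have h6 : (((16778 : ℕ)) : ZMod 7) = ((6 : ℤ) : ZMod 7) := by decide
    rw [h6] at hv
    have hT := hω 6 (by decide)
    rw [← hv] at hT
    have : ‖(1 : ℚ_[7]) - ((6 : ℤ) : ℚ_[7])‖ = 1 := by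
      rw [show (1 : ℚ_[7]) - ((6 : ℤ) : ℚ_[7]) = -((5 : ℕ) : ℚ_[7]) by norm_num, norm_neg]
      exact Padic.norm_natCast_eq_one_iff.mpr (by decide)
    rw [this] at hT
    exact lt_irrefl _ hT
  refine norm_generalizedBernoulli_one_eq_one_of_cert_range θ hθ1 padicValNat_seven_level2_D51
    (fun j => jacobiSym (j : ℤ) 3 * jacobiSym (j : ℤ) 17 * jacobiSym (j : ℤ) 47) 7 (fun j => ?_) 12772555581096083100263277911622144
    theta2_D51_sum (by norm_num) (by norm_num)
  have := norm_sub_le_of_values ω hω θ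
    (fun n => jacobiSym (n : ℤ) 3 * jacobiSym (n : ℤ) 17 * jacobiSym (n : ℤ) 47) 1 le_rfl hθ' j
  simpa using this

/-- **ROUTE U, member `D = −51` (`49a1^{(−51)}`, `N = 49·51² = 127449`): BSD₇ for every globally minimal model of
`49a1^{(−51)}` with `r_an = 1`**, by the bi-prime-member class theorem at `(q₁, q₂, r) = (3, 17, 47)`
with the two certificates above; the descent inputs (no `7`-torsion over `K`, `7 ∤ #Ш(W)`) are discharged
inside the class theorem (Mazur's local step; Buhler–Gross 1985 Ch. II BY NAME, binder `hBG`).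
[cite: KrizLi2019, Thm. 1.20 and Rem. 3.10] [cite: Rubin1983, §0 Thm. C (p. 341)]
[cite: BurungaleFlach2024, Thm 1.1 and Cor. 2] [cite: GrossZagier1986, I.(6.5) and V.(2.1)]
[cite: Miller2011LMS, Thm. 2.5 and (5.1)] [cite: BuhlerGross1985, Ch. II (7.2)(2), (8.3)(1), (9.1) (pp. 16–18)] -/
theorem bsdp_seven_of_twist_cm7_D51
    (hKL : KrizLi2019.thm120_padicLogHeegner_unit_of_bernoulli)
    (hRem : KrizLi2019.rem310_padicLogHeegner_integral)
    (W : WeierstrassCurve ℚ) [W.IsElliptic] [W.IsGloballyMinimal] [NeZero (W.conductorNorm ℤ)]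
    (hW : ∃ C : VariableChange ℚ, C • W = cm7.quadraticTwist ((-((3 * 17 : ℕ)) : ℤ) : ℚ))
    (K : Type) [Field K] [NumberField K] [NeZero (NumberField.discr K).natAbs]
    (hK : IsImaginaryQuadratic K) (hdK : NumberField.discr K = -(47 : ℕ))
    (D : ModularParametrizationData W (W.conductorNorm ℤ))
    (H : HeegnerDatum (W.conductorNorm ℤ) (NumberField.discr K)) (ι : K →+* ℂ) (ιp : K →+* ℚ_[7])
    (P : (W.baseChange K).toAffine.Point)
    (hGZ : gross_zagier (W.conductorNorm ℤ) W K) (hKo : kolyvagin (W.conductorNorm ℤ) W K)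
    (hGZK : rank_eq_analyticRank_of_analyticRank_le_one) (hmod : hasEntireLFunction_rat)
    (hP : WeierstrassCurve.Affine.Point.map ι.toRatAlgHom P = heegnerPointComplex D H)
    (hr1 : W.analyticRank = 1)
    (hLt : (W.quadraticTwist (NumberField.discr K : ℚ)).entireLFunction 1 ≠ 0)
    (Wd : WeierstrassCurve ℚ) [Wd.IsElliptic] [Wd.IsGloballyMinimal] (Cd : VariableChange ℚ)
    (hWd : Cd • W.quadraticTwist (NumberField.discr K : ℚ) = Wd)
    (hBF : bsdTriple_of_hasCM_of_L_one_ne_zero)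
    (hu : padicValRat 7 (Cd.u : ℚ) = 0)
    (hC : Rubin1983.thmC_seven_quadraticField)
    (hBG : BuhlerGross1985.firstDescent_seven_oddTwist_of_bernoulli)
    [Finite (AddCommGroup.torsion (W.baseChange K).toAffine.Point)]
    (crd : (W.baseChange K).toAffine.Point →+ ℤ) (g : (W.baseChange K).toAffine.Point)
    (hg : crd g = 1) (hker : ∀ x, crd x = 0 → IsOfFinAddOrder x)
    (hc7 : ¬ ((7 : ℤ) ∣ D.c)) :
    BSDp W 7 :=
  bsdp_seven_of_twist_cm7_biprime (q₁ := 3) (q₂ := 17) (r := 47) (hq₁ := ⟨by norm_num⟩) (hq₂ := ⟨by norm_num⟩)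
    (hr := ⟨by norm_num⟩) (by norm_num) (by norm_num) (by norm_num)
    (by norm_num) (by norm_num) (by norm_num) (by norm_num) (by norm_num) (by norm_num)
    (by rw [legendreSym_eq_ite 7 (by norm_num)]; decide)
    (by rw [jacobiSym.legendreSym.to_jacobiSym, jacobiSym_prime_eq_ite 3 (by norm_num) (by norm_num)]; decide)
    (by rw [jacobiSym.legendreSym.to_jacobiSym, jacobiSym_prime_eq_ite 17 (by norm_num) (by norm_num)]; decide)
    (norm_generalizedBernoulli_theta1_D51) (norm_generalizedBernoulli_theta2_D51)
    hKL hRem W hW K hK hdK D H ι ιp P hGZ hKo hGZK hmod hP hr1 hLt Wd Cd hWd hBF hu hC hBG crd g hg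
    hker hc7

end Summit.BirchSwinnertonDyer.Rank1Residual.X12.O11.RouteU

end
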